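/-
Copyright: the b2b-balaban cell (near-miss cell 7), T⁴-continuum fan-out, lineage t4-ne7b-p2 (node U5c RENEWAL member).
Released under the licence of the surrounding project.
-/
import Summits.QuantumFields.BalabanUV.T4Continuum.Support.RenewalRecords

/-!
# Spine records: the prefix forest, the product majorant, and every ledger fact PROVED

Summits-side support leaf of the T⁴-continuum cell (rung (B)+1 on a FINITE torus only; NOT infinite volume, NOT the
mass gap, NOT the Clay statement; NOT a proof of the spine estimate NE7b).  Lineage `t4-ne7b-p2` (generation 23),
node U5c, RENEWAL route; leaves N1b (ledger facts) and N2 (product majorant) of the ROUND-2 skeleton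
`t4/skeletons/NE7b-t4-ne7b-p2.md` v1.7 on the carriers of `RenewalRecords`.  [folklore] finite combinatorics over the
lineage's OWN carriers; nothing is quoted from print, nothing printed is asserted, no `[cite:]` tag; none of the cell's
conditionals ((B), BetaPertH) occurs.

WHAT.  §4 THE PREFIX FOREST of a finite family `Pend` of spine records: components = all TRUNCATIONS (drop the newest
edges), roots = no edge, `parent` = drop the newest edge, `last` = end age; `EventForest.parent_mem ∕ last_lt` hold BY
CONSTRUCTION (no hypothesis).  §5 THE PRODUCT MAJORANT `weight ρ π` (root price `ρ root tail`, edge price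
`π (end age) block`) with `weight = price·weight ∘ parent` off roots and `weight = price` on roots, by `rfl`.  §6 THE
LEDGER FACTS on the prefix forest: `hroot_forest` (a root component has age `0`; its grove is the root block scripted
from the bare birth), `hstep_forest` (a non-root component arises from its parent by its newest block, headed by the
undone event at step `j + last`) — both from VALIDITY alone —, `last_le_forest` (`hCmp`),
`weight_root_forest`∕`weight_step_forest`, and the two catalogues: `rootMass_le` (ROOT MASS `≤ B₀` from a root catalogue
`Roots ∋ (root, tail)`), `catalogue_le` (the COMBINED per-parent, per-age CATALOGUE `≤ εc` from a block catalogue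
`Cat P s ∋ (first, rest)`) — both by injectivity of a component into its data.

HONEST DEPENDENCY (cell): continuum YM on T⁴ ⇐ BetaPertH ∧ nine spine estimates (0/9 proved); BetaPertH ⇐ (D1) ∧ (D4)
∧ CAP+tail.  This file changes none of it.
-/

open Finset
open Literature.MathematicalPhysics.QuantumFieldTheory.Balaban1983to89
open T4PersistenceDictionary T4PersistenceRenewal T4PersistenceGrove

namespace Summit.QuantumFields.BalabanUV.T4Continuum.RenewalRecords

/-! ## §4 The prefix forest of a finite family of records — `EventForest` BY CONSTRUCTION -/

section Forest

variable {ε : Type*} [DecidableEq ε]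

/-- **THE PREFIX FOREST** of a finite family of spine records: components = all truncations, roots = bare roots,
`last` = end age, `parent` = undo the newest edge.  `parent_mem` and `last_lt` hold by construction. [folklore] -/
def forest (Pend : Finset (Rec ε)) : EventForest (Rec ε) where
  Cmp := Pend.biUnion Rec.prefixes
  roots := (Pend.biUnion Rec.prefixes).filter fun c => c.hist = []
  last := Rec.last
  parent := Rec.parent
  parent_mem := by
    intro c hc hr
    rw [mem_filter, not_and] at hr
    have hne : c.hist ≠ [] := hr hc
    obtain ⟨r, hrP, hcr⟩ := mem_biUnion.1 hc
    obtain ⟨n, -, rfl⟩ := Rec.mem_prefixes.1 hcr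
    exact mem_biUnion.2 ⟨r, hrP, Rec.parent_cut_mem_prefixes r hne⟩
  last_lt := by
    intro c hc hr
    rw [mem_filter, not_and] at hr
    have hne : c.hist ≠ [] := hr hc
    obtain ⟨e, es, he⟩ := List.exists_cons_of_ne_nil hne
    show endAge c.hist.tail < endAge c.hist
    rw [he, List.tail_cons, endAge]
    omega

omit [DecidableEq ε] in
/-- the end age grows by the gap plus one across an edge [folklore] -/
theorem last_parent_of_cons (c : Rec ε) {e : Edge ε} {es : List (Edge ε)} (he : c.hist = e :: es) :
    c.last = c.parent.last + e.gap + 1 := by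
  simp [Rec.last, Rec.parent, he, endAge]

/-- membership in the components: a truncation of a pending record [folklore] -/
theorem mem_Cmp {Pend : Finset (Rec ε)} {c : Rec ε} :
    c ∈ (forest Pend).Cmp ↔ ∃ r ∈ Pend, ∃ n ≤ r.hist.length, c = r.cut n := by
  simp only [forest, mem_biUnion, Rec.mem_prefixes]

/-- membership in the roots: a component with no edge [folklore] -/
theorem mem_roots {Pend : Finset (Rec ε)} {c : Rec ε} :
    c ∈ (forest Pend).roots ↔ c ∈ (forest Pend).Cmp ∧ c.hist = [] := by
  simp only [forest, mem_filter]

/-- the pending records are components [folklore] -/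
theorem subset_Cmp (Pend : Finset (Rec ε)) : Pend ⊆ (forest Pend).Cmp :=
  fun r hr => mem_biUnion.2 ⟨r, hr, Rec.mem_prefixes_self r⟩

/-- a non-root component has a newest edge [folklore] -/
theorem exists_cons_of_not_root {Pend : Finset (Rec ε)} {c : Rec ε} (hc : c ∈ (forest Pend).Cmp)
    (hr : c ∉ (forest Pend).roots) : ∃ e es, c.hist = e :: es := by
  rw [mem_roots, not_and] at hr
  exact List.exists_cons_of_ne_nil (hr hc)

end Forest

/-! ## §5 The product majorant: weight = product of the block prices along the record -/

section Weight

variable {ε : Type*}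

/-- the product weight of a history from a root weight: newest block price times the rest [folklore] -/
def weightOf (π : ℕ → List (Move ε) → ℝ) (w₀ : ℝ) : List (Edge ε) → ℝ
  | [] => w₀
  | e :: es => π (endAge (e :: es)) e.block * weightOf π w₀ es

namespace Rec

/-- **THE PRODUCT MAJORANT** of a record: root price `ρ root tail` times the block prices `π (end age) block` of
its edges. [folklore] -/
def weight (ρ : ε → List (Move ε) → ℝ) (π : ℕ → List (Move ε) → ℝ) (r : Rec ε) : ℝ :=
  weightOf π (ρ r.root r.tail) r.hist

/-- the PRICE of a component: its newest block's price (the root price on a bare root) [folklore] -/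
def price (ρ : ε → List (Move ε) → ℝ) (π : ℕ → List (Move ε) → ℝ) (r : Rec ε) : ℝ :=
  match r.hist with
  | [] => ρ r.root r.tail
  | e :: _ => π r.last e.block

/-- on a bare root the weight IS the price [folklore] -/
theorem weight_root (ρ : ε → List (Move ε) → ℝ) (π : ℕ → List (Move ε) → ℝ) (r : Rec ε) (hr : r.hist = []) :
    r.weight ρ π = r.price ρ π := by
  simp [weight, price, hr, weightOf]

/-- across an edge the weight IS the price times the parent's weight [folklore] -/
theorem weight_cons (ρ : ε → List (Move ε) → ℝ) (π : ℕ → List (Move ε) → ℝ) (r : Rec ε) {e : Edge ε}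
    {es : List (Edge ε)} (hr : r.hist = e :: es) : r.weight ρ π = r.price ρ π * r.parent.weight ρ π := by
  simp [weight, price, parent, Rec.last, hr, weightOf]

/-- nonnegative prices give a nonnegative weight [folklore] -/
theorem weight_nonneg {ρ : ε → List (Move ε) → ℝ} {π : ℕ → List (Move ε) → ℝ} (hρ : ∀ b t, 0 ≤ ρ b t)
    (hπ : ∀ s b, 0 ≤ π s b) (r : Rec ε) : 0 ≤ r.weight ρ π := by
  unfold weight
  induction r.hist with
  | nil => exact hρ _ _
  | cons e es ih => exact mul_nonneg (hπ _ _) ih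

/-- nonnegative prices give a nonnegative price [folklore] -/
theorem price_nonneg {ρ : ε → List (Move ε) → ℝ} {π : ℕ → List (Move ε) → ℝ} (hρ : ∀ b t, 0 ≤ ρ b t)
    (hπ : ∀ s b, 0 ≤ π s b) (r : Rec ε) : 0 ≤ r.price ρ π := by
  unfold price
  cases r.hist with
  | nil => exact hρ _ _
  | cons e es => exact hπ _ _

end Rec

end Weight

/-! ## §6 The ledger facts and the two catalogues, discharged on the prefix forest -/

section Ledger

variable {ε : Type*} [DecidableEq ε]

/-- **`hroot`**: a root component has age `0` and its grove is the root block scripted from the bare birth. [folklore] -/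
theorem hroot_forest (W : ε → ℕ) (j : ℕ) {Pend : Finset (Rec ε)} (hvalid : ∀ r ∈ Pend, r.Valid W j)
    {c : Rec ε} (hc : c ∈ (forest Pend).Cmp) (hr : c ∈ (forest Pend).roots) :
    (forest Pend).last c = 0 ∧ Script W ({Gen.born c.ev j} : Grove ε) (c.tailEv j) {c.tree j} := by
  obtain ⟨-, hnil⟩ := mem_roots.1 hr
  obtain ⟨r, hrP, n, -, rfl⟩ := mem_Cmp.1 hc
  have hv := Rec.valid_cut (hvalid r hrP) n
  refine ⟨by simp [forest, Rec.last, hnil, endAge], ?_⟩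
  have hs := block_script W hv.1
  simp only [Rec.ev, Rec.tailEv, Rec.tree, hnil, treeOf]
  exact hs

/-- **`hstep`**: a non-root component arises from its parent by the script of its newest block, headed by the undone
event at step `j + last`. [folklore] -/
theorem hstep_forest (W : ε → ℕ) (j : ℕ) {Pend : Finset (Rec ε)} (hvalid : ∀ r ∈ Pend, r.Valid W j)
    {c : Rec ε} (hc : c ∈ (forest Pend).Cmp) (hr : c ∉ (forest Pend).roots) :
    Script W ({((forest Pend).parent c).tree j} : Grove ε) ((c.ev, j + (forest Pend).last c) :: c.tailEv j)
      {c.tree j} := by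
  obtain ⟨e, es, he⟩ := exists_cons_of_not_root hc hr
  obtain ⟨r, hrP, n, -, rfl⟩ := mem_Cmp.1 hc
  have hv := (Rec.valid_cut (hvalid r hrP) n).2
  show Script W ({(r.cut n).parent.tree j} : Grove ε) (((r.cut n).ev, j + (r.cut n).last) :: (r.cut n).tailEv j)
    {(r.cut n).tree j}
  rw [Rec.ev_cons_tailEv j (r.cut n) e es he]
  have hh : (r.cut n).hist = e :: es := he
  simp only [Rec.tree, Rec.parent, Rec.last, hh, List.tail_cons, treeOf]
  rw [hh] at hv
  exact block_script W hv.2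

/-- **`hCmp`**: components are no older than the pending records they truncate. [folklore] -/
theorem last_le_forest {Pend : Finset (Rec ε)} {Ah : ℕ} (hlast : ∀ r ∈ Pend, r.last ≤ Ah) {c : Rec ε}
    (hc : c ∈ (forest Pend).Cmp) : (forest Pend).last c ≤ Ah := by
  obtain ⟨r, hrP, n, -, rfl⟩ := mem_Cmp.1 hc
  exact (Rec.endAge_drop_le r.hist n).trans (hlast r hrP)

/-- **`hωroot`**: on roots the product weight is the price. [folklore] -/
theorem weight_root_forest (ρ : ε → List (Move ε) → ℝ) (π : ℕ → List (Move ε) → ℝ) {Pend : Finset (Rec ε)}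
    {c : Rec ε} (hr : c ∈ (forest Pend).roots) : c.weight ρ π = c.price ρ π :=
  Rec.weight_root ρ π c (mem_roots.1 hr).2

/-- **`hωstep`**: off roots the product weight is the price times the parent's weight. [folklore] -/
theorem weight_step_forest (ρ : ε → List (Move ε) → ℝ) (π : ℕ → List (Move ε) → ℝ) {Pend : Finset (Rec ε)}
    {c : Rec ε} (hc : c ∈ (forest Pend).Cmp) (hr : c ∉ (forest Pend).roots) :
    c.weight ρ π = c.price ρ π * ((forest Pend).parent c).weight ρ π := by
  obtain ⟨e, es, he⟩ := exists_cons_of_not_root hc hr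
  exact Rec.weight_cons ρ π c he

/-- **THE ROOT MASS FROM A ROOT CATALOGUE**: if every pending record's (root, root block) lies in a finite catalogue
`Roots` whose paired mass is `≤ B₀`, so is the forest's root pairing mass (distinct root components have distinct
data). [folklore] -/
theorem rootMass_le (W : ε → ℕ) (j : ℕ) (ρ : ε → List (Move ε) → ℝ) (π : ℕ → List (Move ε) → ℝ)
    (hρ : ∀ b t, 0 ≤ ρ b t) (hπ : ∀ s b, 0 ≤ π s b) {z₁ B₀ : ℝ} (hz₁ : 0 ≤ z₁) {Pend : Finset (Rec ε)}
    (Roots : Finset (ε × List (Move ε))) (hroots : ∀ r ∈ Pend, (r.root, r.tail) ∈ Roots)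
    (hB : ∑ p ∈ Roots, ρ p.1 p.2 * z₁ ^ (W p.1 + blockWindow W p.2) ≤ B₀) :
    ∑ c ∈ (forest Pend).Cmp with c ∈ (forest Pend).roots, c.price ρ π * z₁ ^ (booking W Rec.ev (Rec.tailEv j) c)
      ≤ B₀ := by
  classical
  -- the root component of the data
  let g : ε × List (Move ε) → Rec ε := fun p => ⟨p.1, p.2, []⟩
  have hg : Function.Injective g := fun p q h => by
    simp only [g, Rec.mk.injEq] at h
    exact Prod.ext h.1 h.2.1
  have hsub : ((forest Pend).Cmp.filter fun c => c ∈ (forest Pend).roots) ⊆ Roots.image g := by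
    intro c hc
    obtain ⟨hcC, hcr⟩ := mem_filter.1 hc
    obtain ⟨-, hnil⟩ := mem_roots.1 hcr
    obtain ⟨r, hrP, n, -, rfl⟩ := mem_Cmp.1 hcC
    refine mem_image.2 ⟨(r.root, r.tail), hroots r hrP, ?_⟩
    have hh : r.hist.drop n = [] := hnil
    simp only [g, Rec.cut, hh]
  calc ∑ c ∈ (forest Pend).Cmp with c ∈ (forest Pend).roots, c.price ρ π * z₁ ^ (booking W Rec.ev (Rec.tailEv j) c)
      ≤ ∑ c ∈ Roots.image g, c.price ρ π * z₁ ^ (booking W Rec.ev (Rec.tailEv j) c) :=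
        sum_le_sum_of_subset_of_nonneg hsub fun c _ _ =>
          mul_nonneg (Rec.price_nonneg hρ hπ c) (pow_nonneg hz₁ _)
    _ = ∑ p ∈ Roots, (g p).price ρ π * z₁ ^ (booking W Rec.ev (Rec.tailEv j) (g p)) :=
        sum_image fun p _ q _ h => hg h
    _ = ∑ p ∈ Roots, ρ p.1 p.2 * z₁ ^ (W p.1 + blockWindow W p.2) := by
        refine sum_congr rfl fun p _ => ?_
        rw [Rec.booking_root W j (g p) rfl]
        rfl
    _ ≤ B₀ := hB

/-- **THE COMBINED CATALOGUE FROM A BLOCK CATALOGUE**: if the newest block `(first, rest)` of every component lies in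
a finite catalogue `Cat (parent) (end age)` whose paired price mass is `≤ εc` for EVERY parent and age, then the
forest's per-parent, per-age children sum is `≤ εc` (distinct children of one parent at one age have distinct blocks).
[folklore] -/
theorem catalogue_le (W : ε → ℕ) (j : ℕ) (ρ : ε → List (Move ε) → ℝ) (π : ℕ → List (Move ε) → ℝ)
    (hρ : ∀ b t, 0 ≤ ρ b t) (hπ : ∀ s b, 0 ≤ π s b) {z₁ εc : ℝ} (hz₁ : 0 ≤ z₁) {Pend : Finset (Rec ε)}
    (Cat : Rec ε → ℕ → Finset (Move ε × List (Move ε)))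
    (hmem : ∀ c ∈ (forest Pend).Cmp, ∀ e es, c.hist = e :: es → (e.first, e.rest) ∈ Cat c.parent c.last)
    (hcat : ∀ P s, ∑ p ∈ Cat P s, π s (p.1 :: p.2) * z₁ ^ blockWindow W (p.1 :: p.2) ≤ εc)
    {P : Rec ε} {s : ℕ} (hs : (forest Pend).last P < s) :
    ∑ c ∈ (forest Pend).Cmp with ((forest Pend).last c = s ∧ c ∉ (forest Pend).roots ∧ (forest Pend).parent c = P),
      c.price ρ π * z₁ ^ (booking W Rec.ev (Rec.tailEv j) c) ≤ εc := by
  classical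
  -- the child of `P` at age `s` with newest block `(first, rest)`
  let g : Move ε × List (Move ε) → Rec ε := fun p => ⟨P.root, P.tail, ⟨s - P.last - 1, p.1, p.2⟩ :: P.hist⟩
  have hg : Function.Injective g := fun p q h => by
    simp only [g, Rec.mk.injEq, List.cons.injEq, Edge.mk.injEq, true_and, and_true] at h
    exact Prod.ext h.1 h.2
  have hPl : (forest Pend).last P = P.last := rfl
  have hsub : ((forest Pend).Cmp.filter fun c =>
      (forest Pend).last c = s ∧ c ∉ (forest Pend).roots ∧ (forest Pend).parent c = P) ⊆ (Cat P s).image g := by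
    intro c hc
    obtain ⟨hcC, hls, hr, hpar⟩ := mem_filter.1 hc
    obtain ⟨e, es, he⟩ := exists_cons_of_not_root hcC hr
    have hpar' : c.parent = P := hpar
    have hls' : c.last = s := hls
    have hlast := last_parent_of_cons c he
    rw [hpar', hls'] at hlast
    refine mem_image.2 ⟨(e.first, e.rest), ?_, ?_⟩
    · have h := hmem c hcC e es he
      rwa [hpar', hls'] at h
    · have hce : c = ⟨P.root, P.tail, ⟨e.gap, e.first, e.rest⟩ :: P.hist⟩ := by
        rw [← hpar']
        obtain ⟨a, b, l⟩ := c
        simp only at he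
        subst he
        rfl
      have hgap : e.gap = s - P.last - 1 := by omega
      rw [hce, hgap]
  calc ∑ c ∈ (forest Pend).Cmp with
          ((forest Pend).last c = s ∧ c ∉ (forest Pend).roots ∧ (forest Pend).parent c = P),
          c.price ρ π * z₁ ^ (booking W Rec.ev (Rec.tailEv j) c)
      ≤ ∑ c ∈ (Cat P s).image g, c.price ρ π * z₁ ^ (booking W Rec.ev (Rec.tailEv j) c) :=
        sum_le_sum_of_subset_of_nonneg hsub fun c _ _ =>
          mul_nonneg (Rec.price_nonneg hρ hπ c) (pow_nonneg hz₁ _)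
    _ = ∑ p ∈ Cat P s, (g p).price ρ π * z₁ ^ (booking W Rec.ev (Rec.tailEv j) (g p)) :=
        sum_image fun p _ q _ h => hg h
    _ = ∑ p ∈ Cat P s, π s (p.1 :: p.2) * z₁ ^ blockWindow W (p.1 :: p.2) := by
        refine sum_congr rfl fun p _ => ?_
        have hs' : P.last < s := hs
        have hl : (g p).last = s := by
          show P.last + (s - P.last - 1) + 1 = s
          omega
        rw [Rec.booking_edge W j (g p) _ P.hist rfl]
        simp only [Rec.price, g, hl, Edge.block]
    _ ≤ εc := hcat P s

end Ledger

end Summit.QuantumFields.BalabanUV.T4Continuum.RenewalRecords
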